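import Literature.Computability.Complexity.Circuit
import Mathlib.Data.List.GetD
import Mathlib.Data.List.OfFn
import HarnessLib

/-!
# Boolean circuits: gate-by-gate semantics, transcripts, padding (general input type)

The library's `Circuit ι` (`Circuit.lean`) computes its wire values by a left fold
(`Circuit.wireVals`). This file spells that fold out gate by gate for a GENERAL input type `ι`:

* `wireVal x vals w`, `gateValue x vals g`, `transcript x vals gs` with
  `wireVals_eq_transcript : C.wireVals x = transcript x [] C.gates` and
  `eval_eq_wireVal : C.eval x = wireVal x (transcript x [] C.gates) C.output`;
* the true transcript is the unique solution of the gate equations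
  (`getD_transcript_eq_gateValue`, `eq_transcript_of_gate_equations`), the combinatorial heart of
  the transcript arithmetization behind Valiant's criterion (`CircuitArithmetization.lean`);
* `btable g`, the binary truth table of a gate of fan-in `≤ 2`;
* `Circuit.pad`, `Circuit.padTo`: appending dummy gates does not change the computed function
  (`Circuit.eval_pad`), used to give all circuits of a bounded-size family the same number of
  gate variables.

Librarian note. `Literature/Computability/Complexity/CircuitEval.lean` contains the special case
`ι = Fin n` of the first group under the names `CircEval.wval`, `CircEval.gateVal`,
`CircEval.valsFrom`, `CircEval.valsFrom_cons`, `CircEval.length_valsFrom`,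
`CircEval.wireVals_eq_valsFrom`, `CircEval.eval_eq_wval`, `CircEval.table` (they predate this
file); those should be re-pointed to the general versions here.

## References

* S. Arora, B. Barak, *Computational Complexity* (2009), Def. 6.1, Rem. 6.4 (circuits as
  straight-line programs).
* P. Bürgisser, *Completeness and Reduction in Algebraic Complexity Theory*, Springer 2000,
  proof of Prop. 2.20 (the transcript of a computation).
-/

namespace Literature.Computability.Complexity

universe v

/-! ### Wire values, gate values, transcripts -/

variable {ι : Type v}

/-- The value of a wire given the input and the values of the earlier gates. [cite: AroraBarak2009, Rem. 6.4] -/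
def wireVal (x : ι → Bool) (vals : List Bool) : ι ⊕ ℕ → Bool
  | .inl i => x i
  | .inr m => vals.getD m false

/-- The value of a gate given the input and the values of the earlier gates. [cite: AroraBarak2009, Rem. 6.4] -/
def gateValue (x : ι → Bool) (vals : List Bool) (g : Gate ι) : Bool :=
  g.op fun a => wireVal x vals (g.args a)

/-- The values of a list of gates evaluated after the values `vals`. [cite: AroraBarak2009, Rem. 6.4] -/
def transcript (x : ι → Bool) (vals : List Bool) (gs : List (Gate ι)) : List Bool :=
  gs.foldl (fun vs g => vs ++ [gateValue x vs g]) vals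

/-- `transcript` on a cons. [folklore] -/
theorem transcript_cons (x : ι → Bool) (vals : List Bool) (g : Gate ι) (gs : List (Gate ι)) :
    transcript x vals (g :: gs) = transcript x (vals ++ [gateValue x vals g]) gs := rfl

/-- Length of `transcript`. [folklore] -/
theorem length_transcript (x : ι → Bool) : ∀ (vals : List Bool) (gs : List (Gate ι)),
    (transcript x vals gs).length = vals.length + gs.length
  | vals, [] => by simp [transcript]
  | vals, g :: gs => by
    rw [transcript_cons, length_transcript, List.length_append, List.length_cons, List.length_cons, List.length_nil]
    omega

/-- The circuit's wire values are `transcript x []`. [cite: AroraBarak2009, Rem. 6.4] -/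
theorem wireVals_eq_transcript (C : Circuit ι) (x : ι → Bool) : C.wireVals x = transcript x [] C.gates := by
  unfold Circuit.wireVals transcript
  congr 1

/-- The circuit's output is the value of the output wire. [cite: AroraBarak2009, Def. 6.1] -/
theorem eval_eq_wireVal (C : Circuit ι) (x : ι → Bool) : C.eval x = wireVal x (transcript x [] C.gates) C.output := by
  rw [← wireVals_eq_transcript]
  unfold Circuit.eval
  cases C.output <;> rfl

/-- The binary truth table of a gate of arity `≤ 2`. [folklore] -/
def btable (g : Gate ι) (b0 b1 : Bool) : Bool :=
  g.op fun a => if a.val = 0 then b0 else b1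



/-! ### The true transcript: fixed point and uniqueness -/

/-- A gate reads only values below its own index: two value lists agreeing below `j` give the
same gate value (for a gate whose back-references are `< j`). [cite: AroraBarak2009, Rem. 6.4] -/
theorem gateValue_congr (x : ι → Bool) {vals₁ vals₂ : List Bool} {g : Gate ι} {j : ℕ}
    (hg : ∀ (a : Fin g.arity) (m : ℕ), g.args a = .inr m → m < j)
    (h : ∀ m < j, vals₁.getD m false = vals₂.getD m false) : gateValue x vals₁ g = gateValue x vals₂ g := by
  unfold gateValue
  congr 1
  funext a
  cases ha : g.args a with
  | inl i => rfl
  | inr m => simp only [wireVal]; exact h m (hg a m ha)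

/-- `transcript` over an appended gate. [folklore] -/
theorem transcript_append_singleton (x : ι → Bool) (vals : List Bool) (gs : List (Gate ι)) (g : Gate ι) :
    transcript x vals (gs ++ [g]) = transcript x vals gs ++ [gateValue x (transcript x vals gs) g] := by
  simp [transcript, List.foldl_append]

/-- `transcript x [] (take j)` is a prefix of `transcript x [] gates`. [folklore] -/
theorem transcript_take_prefix (x : ι → Bool) (gs : List (Gate ι)) (j : ℕ) (hj : j ≤ gs.length) :
    transcript x [] gs = transcript x [] (gs.take j) ++ (transcript x [] gs).drop j := by
  have hsplit : gs = gs.take j ++ gs.drop j := (List.take_append_drop j gs).symm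
  have hfold : transcript x [] gs = transcript x (transcript x [] (gs.take j)) (gs.drop j) := by
    conv_lhs => rw [hsplit]
    simp only [transcript, List.foldl_append]
  have hpre : ∀ (vals : List Bool) (l : List (Gate ι)), ∃ t, transcript x vals l = vals ++ t := by
    intro vals l
    induction l generalizing vals with
    | nil => exact ⟨[], by simp [transcript]⟩
    | cons g l ih =>
      obtain ⟨t, ht⟩ := ih (vals ++ [gateValue x vals g])
      exact ⟨gateValue x vals g :: t, by rw [transcript_cons, ht]; simp⟩
  obtain ⟨t, ht⟩ := hpre (transcript x [] (gs.take j)) (gs.drop j)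
  have hlen : (transcript x [] (gs.take j)).length = j := by
    rw [length_transcript]; simp; omega
  rw [hfold, ht, List.drop_append_of_le_length hlen.ge, List.drop_of_length_le hlen.le, List.nil_append]

/-- **The true transcript satisfies the gate equations**: entry `j` of `transcript x [] Q.gates` is
gate `j` applied to the transcript. [cite: AroraBarak2009, Rem. 6.4] -/
theorem getD_transcript_eq_gateValue (Q : Circuit ι) (x : ι → Bool) (j : ℕ) (hj : j < Q.gates.length) :
    (transcript x [] Q.gates).getD j false = gateValue x (transcript x [] Q.gates) (Q.gates[j]) := by
  set W := transcript x [] Q.gates with hW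
  have hlenW : W.length = Q.gates.length := by rw [hW, length_transcript]; simp
  -- the prefix of length `j + 1`
  have htake : Q.gates.take (j + 1) = Q.gates.take j ++ [Q.gates[j]] := by
    rw [List.take_add_one, List.getElem?_eq_getElem hj]; rfl
  have hpre := transcript_take_prefix x Q.gates (j + 1) hj
  rw [htake, transcript_append_singleton] at hpre
  have hlenj : (transcript x [] (Q.gates.take j)).length = j := by rw [length_transcript]; simp; omega
  -- entry `j`
  have hget : W.getD j false = gateValue x (transcript x [] (Q.gates.take j)) (Q.gates[j]) := by
    rw [← hW] at hpre
    rw [hpre, List.getD_eq_getElem?_getD, List.append_assoc, List.getElem?_append_right hlenj.le, hlenj,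
      Nat.sub_self]
    simp
  rw [hget]
  -- the prefix agrees with `W` below `j`
  refine gateValue_congr x (fun a m ha => Q.wf j hj a m ha) fun m hm => ?_
  have hpre' := transcript_take_prefix x Q.gates j hj.le
  rw [← hW] at hpre'
  rw [hpre', List.getD_eq_getElem?_getD, List.getD_eq_getElem?_getD, List.getElem?_append_left (by rw [hlenj]; exact hm)]

/-- **Uniqueness of transcripts**: a value list of the right length satisfying all gate equations
is the true transcript. [cite: Burgisser2000, proof of Prop. 2.20] -/
theorem eq_transcript_of_gate_equations (Q : Circuit ι) (x : ι → Bool) (vals : List Bool)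
    (hlen : vals.length = Q.gates.length)
    (h : ∀ j (hj : j < Q.gates.length), vals.getD j false = gateValue x vals (Q.gates[j])) :
    vals = transcript x [] Q.gates := by
  set W := transcript x [] Q.gates with hW
  have hlenW : W.length = Q.gates.length := by rw [hW, length_transcript]; simp
  have key : ∀ j, j < Q.gates.length → vals.getD j false = W.getD j false := by
    intro j
    induction j using Nat.strong_induction_on with
    | _ j ih =>
      intro hj
      rw [h j hj, hW, getD_transcript_eq_gateValue Q x j hj, ← hW]
      exact gateValue_congr x (fun a m ha => Q.wf j hj a m ha) fun m hm => ih m hm (hm.trans hj)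
  apply List.ext_getElem (by rw [hlen, hlenW])
  intro i h1 h2
  have := key i (by rw [← hlen]; exact h1)
  rwa [List.getD_eq_getElem _ _ h1, List.getD_eq_getElem _ _ h2] at this


/-! ### Padding a circuit with dummy gates -/

namespace Circuit

variable {ι : Type*}

/-- A dummy gate: arity `0`, constant `0`. [folklore] -/
def dummyGate : Gate ι := ⟨0, fun _ => false, Fin.elim0⟩

/-- Append `t` dummy gates (the output is unchanged). [folklore] -/
def pad (Q : Circuit ι) (t : ℕ) : Circuit ι where
  gates := Q.gates ++ List.replicate t dummyGate
  output := Q.output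
  wf := by
    intro j hj a m h
    generalize hg : (Q.gates ++ List.replicate t dummyGate)[j] = g at a h
    by_cases hjQ : j < Q.gates.length
    · have : g = Q.gates[j] := by rw [← hg, List.getElem_append_left hjQ]
      subst this
      exact Q.wf j hjQ a m h
    · have : g = dummyGate := by
        rw [← hg, List.getElem_append_right (by omega)]
        simp
      subst this
      exact a.elim0
  wf_output m hm := by
    rw [List.length_append]
    exact Nat.lt_add_right _ (Q.wf_output m hm)

/-- Size of the padded circuit. [folklore] -/
@[simp] theorem size_pad (Q : Circuit ι) (t : ℕ) : (Q.pad t).size = Q.size + t := by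
  simp [pad, size]

/-- Padding keeps the basis `B₂` (fan-in `≤ 2`). [folklore] -/
theorem isOver_B2_pad (Q : Circuit ι) (t : ℕ) (h : Q.IsOver B2) : (Q.pad t).IsOver B2 := by
  intro g hg
  simp only [pad, List.mem_append, List.mem_replicate] at hg
  rcases hg with hg | ⟨-, rfl⟩
  · exact h g hg
  · exact Nat.zero_le _

/-- `transcript` extends its accumulator. [folklore] -/
theorem transcript_prefix (x : ι → Bool) (vals : List Bool) (l : List (Gate ι)) :
    ∃ t, transcript x vals l = vals ++ t := by
  induction l generalizing vals with
  | nil => exact ⟨[], by simp [transcript]⟩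
  | cons g l ih =>
    obtain ⟨t, ht⟩ := ih (vals ++ [gateValue x vals g])
    exact ⟨gateValue x vals g :: t, by rw [transcript_cons, ht]; simp⟩

/-- **Padding does not change the computed function.** [folklore] -/
theorem eval_pad (Q : Circuit ι) (t : ℕ) (x : ι → Bool) : (Q.pad t).eval x = Q.eval x := by
  rw [eval_eq_wireVal, eval_eq_wireVal]
  have hgates : (Q.pad t).gates = Q.gates ++ List.replicate t dummyGate := rfl
  have hout : (Q.pad t).output = Q.output := rfl
  rw [hgates, hout]
  have hfold : transcript x [] (Q.gates ++ List.replicate t dummyGate) =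
      transcript x (transcript x [] Q.gates) (List.replicate t dummyGate) := by
    simp only [transcript, List.foldl_append]
  obtain ⟨t', ht'⟩ := transcript_prefix x (transcript x [] Q.gates) (List.replicate t dummyGate)
  rw [hfold, ht']
  cases hco : Q.output with
  | inl i => rfl
  | inr m =>
    have hm := Q.wf_output m hco
    have hlen : (transcript x [] Q.gates).length = Q.gates.length := by rw [length_transcript]; simp
    simp only [wireVal]
    rw [List.getD_append _ _ _ _ (by rw [hlen]; exact hm)]

/-- Pad to size exactly `M`. [folklore] -/
def padTo (Q : Circuit ι) (M : ℕ) : Circuit ι := Q.pad (M - Q.size)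

/-- The padded circuit has size `M` (if `|Q| ≤ M`). [folklore] -/
theorem size_padTo (Q : Circuit ι) {M : ℕ} (h : Q.size ≤ M) : (Q.padTo M).size = M := by
  rw [padTo, size_pad]; omega

/-- `padTo` keeps the basis `B₂`. [folklore] -/
theorem isOver_B2_padTo (Q : Circuit ι) (M : ℕ) (h : Q.IsOver B2) : (Q.padTo M).IsOver B2 :=
  isOver_B2_pad Q _ h

/-- `padTo` does not change the computed function. [folklore] -/
theorem eval_padTo (Q : Circuit ι) (M : ℕ) (x : ι → Bool) : (Q.padTo M).eval x = Q.eval x :=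
  eval_pad Q _ x

end Circuit


end Literature.Computability.Complexity
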